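import Summits.ABC.ABC.Theses.RibetTakahashiSplit
import Summits.ABC.ABC.Theorems.RibetTakahashiSplitWeightedSzpiroBoundAbc
import Literature.NumberTheory.EllipticCurves.SzpiroLocalDataProofs
import Literature.NumberTheory.EllipticCurves.SzpiroOfAbcProofs
import Literature.NumberTheory.EllipticCurves.SzpiroFreyProofs
import Literature.NumberTheory.DiophantineGeometry.MinimalDiscriminantSmulProofs
import Literature.NumberTheory.DiophantineGeometry.MinimalDiscriminantFiniteProofs
import Literature.NumberTheory.DiophantineGeometry.MinimalDiscriminantProofs
import Literature.NumberTheory.Sieve.DivisorBound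
import Summits.ABC.ABC.Theorems.FreyDegreeBound.Negative.LevelAndConductor

/-!
# `ThinWeightedSzpiro` (stmt-ABC-17927, route RibetTakahashiSplit, crux r3″): load-bearing hypotheses

Negative-side support lemmas from the crux disprover's cycle-1 attack
(`Cruxes/ThinWeightedSzpiro/Disproof.lean`, §§1–2). The crux is
`∃ θ > 0 ∀ ε > 0 ∀ K ∃ C ∀ W₀ : WeierstrassCurve ℤ` (elliptic over `ℚ`, minimal at every prime,
semistable away from `2`, θ-thin: `T ≤ K N^θ`), `max(|Δ(W₀)|, |c₄(W₀)|³) ≤ C (N·T)^{6+ε}`.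

* `thinWeightedSzpiro_false_without_isElliptic` — dropping `(W₀.baseChange ℚ).IsElliptic` is fatal for
  EVERY class exponent `θ`: the nodal cubics `y² = (x − k)²(x + 2k)` (`Δ = 0`, `c₄ = 144k²`) have the
  junk values `N = 1`, `T = 1`, every integral model minimal, and are thin with `K = 1`.
* `thinWeightedSzpiro_false_without_minimality` — dropping `∀ v, IsMinimalAt v` is fatal for EVERY `θ`:
  the rescalings `y² = x³ − k⁴x` of `y² = x³ − x` have `N ∣ 64`, `T ≤ 6 ≤ 6N^θ` (isomorphism
  invariants) but `Δ = 64k¹²`. Any proof must control `max(|Δ|, |c₄|³)` through the MINIMAL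
  discriminant (`minimalDiscriminantNorm_eq_natAbs_holds`), never through the model.

(The complementary facts — "semistable away from 2" and the class condition are NOT load-bearing for
truth, both removals being consequences of `ABC` — are in the Disproof file, §3.)
-/

set_option linter.dupNamespace false

namespace Summit.ABC.ABC.Theorems.ThinWeightedSzpiro.Negative

open WeierstrassCurve IsDedekindDomain
open Summit.ABC.ABC.Theses.RibetTakahashiSplit
open Literature.NumberTheory.EllipticCurves

/-! ## 1. Load-bearing hypothesis: ellipticity (`Δ ≠ 0`)

Dropping `(W₀.baseChange ℚ).IsElliptic` makes the statement FALSE for EVERY `θ`: for a singular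
integral equation every integral model is minimal, `N = 1` (landed junk-value lemma
`FreyDegreeBound.Negative.conductorNorm_of_Δ_eq_zero`), `T = 1`, so the class condition reads `1 ≤ K`
and the bound `|c₄|³ ≤ C`, while the nodal cubics `y² = (x − k)²(x + 2k)` have `c₄ = 144 k²`
(parent crux disproof `Cruxes/WeightedSzpiroBound/Disproof.lean` §1, re-proved with the weight). -/

/-- The crux with the hypothesis `(W₀.baseChange ℚ).IsElliptic` removed (everything else verbatim). -/
def ThinWeightedSzpiroWithoutIsElliptic : Prop :=
  ∃ θ : ℝ, 0 < θ ∧ ∀ ε : ℝ, 0 < ε → ∀ K : ℝ, ∃ C : ℝ, ∀ W₀ : WeierstrassCurve ℤ,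
    (∀ v : HeightOneSpectrum ℤ, (W₀.baseChange ℚ).IsMinimalAt v) →
    (∀ p : ℕ, p.Prime → p ≠ 2 → ¬ p ^ 2 ∣ (W₀.baseChange ℚ).conductorNorm ℤ) →
    ((∏ p ∈ ((W₀.baseChange ℚ).conductorNorm ℤ).primeFactors with
        ¬ p ^ 2 ∣ (W₀.baseChange ℚ).conductorNorm ℤ,
        ((W₀.baseChange ℚ).minimalDiscriminantNorm ℤ).factorization p : ℕ) : ℝ) ≤
      K * (((W₀.baseChange ℚ).conductorNorm ℤ : ℕ) : ℝ) ^ θ →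
    ((max |W₀.Δ| (|W₀.c₄| ^ 3) : ℤ) : ℝ) ≤ C * ((((W₀.baseChange ℚ).conductorNorm ℤ : ℕ) : ℝ) *
      ((∏ p ∈ ((W₀.baseChange ℚ).conductorNorm ℤ).primeFactors with
        ¬ p ^ 2 ∣ (W₀.baseChange ℚ).conductorNorm ℤ,
        ((W₀.baseChange ℚ).minimalDiscriminantNorm ℤ).factorization p : ℕ) : ℝ)) ^ (6 + ε)

/-- The nodal cubic `y² = x³ − 3k²x + 2k³ = (x − k)²(x + 2k)` over `ℤ`. -/
def nodalModel (k : ℤ) : WeierstrassCurve ℤ := ⟨0, 0, 0, -3 * k ^ 2, 2 * k ^ 3⟩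

/-- `Δ = 0` for the nodal cubic. [folklore] -/
theorem nodalModel_Δ (k : ℤ) : (nodalModel k).Δ = 0 := by
  simp only [nodalModel, WeierstrassCurve.Δ, WeierstrassCurve.b₂, WeierstrassCurve.b₄,
    WeierstrassCurve.b₆, WeierstrassCurve.b₈]
  ring

/-- `c₄ = 144 k²` for the nodal cubic. [folklore] -/
theorem nodalModel_c₄ (k : ℤ) : (nodalModel k).c₄ = 144 * k ^ 2 := by
  simp only [nodalModel, WeierstrassCurve.c₄, WeierstrassCurve.b₂, WeierstrassCurve.b₄]
  ring

/-- A singular integral equation over `ℤ` is minimal at every prime. [folklore] -/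
theorem isMinimalAt_baseChange_int_of_Δ_eq_zero (W₀ : WeierstrassCurve ℤ) (hΔ : W₀.Δ = 0)
    (v : HeightOneSpectrum ℤ) : (W₀.baseChange ℚ).IsMinimalAt v := by
  rw [IsMinimalAt,
    isMinimal_iff_of_le_one_iff (valued_le_one_iff_mem_range_adicCompletionIntegers v)]
  refine ⟨isIntegralAt_baseChange_int v W₀, fun C _ ↦ ?_⟩
  have h0 : ((W₀.baseChange ℚ).baseChange (v.adicCompletion ℚ)).Δ = 0 := by
    rw [baseChange, map_Δ, baseChange_int_Δ, hΔ, Int.cast_zero, map_zero]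
  rw [variableChange_Δ, h0, mul_zero]

/-- **Any proof of the crux must use ellipticity**: the crux with `IsElliptic` dropped is false,
whatever the class exponent `θ`. Witness: `nodalModel k` (`Δ = 0`, `c₄ = 144k²`, junk `N = T = 1`,
θ-thin with `K = 1`), at `ε = 1`, `k = ⌈C⌉₊ + 1`. [folklore] -/
theorem thinWeightedSzpiro_false_without_isElliptic : ¬ ThinWeightedSzpiroWithoutIsElliptic := by
  rintro ⟨θ, -, h⟩
  obtain ⟨C, hC⟩ := h 1 one_pos 1
  set k : ℕ := ⌈C⌉₊ + 1 with hk
  have hkC : C < k := by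
    have := Nat.le_ceil C
    push_cast [hk]
    linarith
  have hk1 : (1 : ℝ) ≤ k := by exact_mod_cast Nat.succ_le_succ (Nat.zero_le _)
  have hΔ : (nodalModel k).Δ = 0 := nodalModel_Δ k
  have hΔ' : ((nodalModel k).baseChange ℚ).Δ = 0 := by rw [baseChange_int_Δ, hΔ, Int.cast_zero]
  have hN : ((nodalModel k).baseChange ℚ).conductorNorm ℤ = 1 :=
    FreyDegreeBound.Negative.conductorNorm_of_Δ_eq_zero _ hΔ'
  have key := hC (nodalModel k) (isMinimalAt_baseChange_int_of_Δ_eq_zero _ hΔ) (by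
    intro p hp _ hdvd
    have h1 : p ^ 2 ≤ 1 := Nat.le_of_dvd one_pos (hN ▸ hdvd)
    have h2 := hp.two_le
    nlinarith)
  rw [hN, hΔ, nodalModel_c₄] at key
  simp only [Nat.primeFactors_one, Finset.filter_empty, Finset.prod_empty, Nat.cast_one, mul_one,
    Real.one_rpow, le_refl, forall_const] at key
  push_cast at key
  have hx : (k : ℝ) ≤ 144 * (k : ℝ) ^ 2 := by nlinarith
  have hy : 144 * (k : ℝ) ^ 2 ≤ (144 * (k : ℝ) ^ 2) ^ 3 := le_self_pow₀ (by nlinarith) (by norm_num)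
  have hz : (144 * (k : ℝ) ^ 2) ^ 3 ≤ max |(0 : ℝ)| (|144 * (k : ℝ) ^ 2| ^ 3) :=
    le_max_of_le_right (by rw [abs_of_nonneg (by positivity)])
  linarith


/-! ## 2. Load-bearing hypothesis: minimality of the integral model at every prime

Dropping `∀ v, (W₀.baseChange ℚ).IsMinimalAt v` makes the statement FALSE for EVERY `θ`: `N` and
`T` are isomorphism invariants of `E / ℚ`, so the rescalings `y² = x³ − k⁴ x` of `y² = x³ − x`
(`N ∣ 64`, `T ≤ 6`, hence θ-thin with `K = 6` for every `θ ≥ 0`) stay in the class while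
`Δ = 64 k¹²` is unbounded (parent crux disproof §2, re-proved with the class condition). So any
proof must route `max(|Δ(W₀)|, |c₄(W₀)|³)` through the MINIMAL discriminant
(`minimalDiscriminantNorm_eq_natAbs_holds`), never through the model. -/

/-- The crux with the minimality hypothesis removed (everything else verbatim). -/
def ThinWeightedSzpiroWithoutMinimality : Prop :=
  ∃ θ : ℝ, 0 < θ ∧ ∀ ε : ℝ, 0 < ε → ∀ K : ℝ, ∃ C : ℝ, ∀ W₀ : WeierstrassCurve ℤ,
    (W₀.baseChange ℚ).IsElliptic →
    (∀ p : ℕ, p.Prime → p ≠ 2 → ¬ p ^ 2 ∣ (W₀.baseChange ℚ).conductorNorm ℤ) →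
    ((∏ p ∈ ((W₀.baseChange ℚ).conductorNorm ℤ).primeFactors with
        ¬ p ^ 2 ∣ (W₀.baseChange ℚ).conductorNorm ℤ,
        ((W₀.baseChange ℚ).minimalDiscriminantNorm ℤ).factorization p : ℕ) : ℝ) ≤
      K * (((W₀.baseChange ℚ).conductorNorm ℤ : ℕ) : ℝ) ^ θ →
    ((max |W₀.Δ| (|W₀.c₄| ^ 3) : ℤ) : ℝ) ≤ C * ((((W₀.baseChange ℚ).conductorNorm ℤ : ℕ) : ℝ) *
      ((∏ p ∈ ((W₀.baseChange ℚ).conductorNorm ℤ).primeFactors with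
        ¬ p ^ 2 ∣ (W₀.baseChange ℚ).conductorNorm ℤ,
        ((W₀.baseChange ℚ).minimalDiscriminantNorm ℤ).factorization p : ℕ) : ℝ)) ^ (6 + ε)

/-- The global minimal model `y² = x³ − x` (Cremona 32a2; `Δ = 64`, `c₄ = 48`). -/
def baseModel : WeierstrassCurve ℤ := ⟨0, 0, 0, -1, 0⟩

/-- The rescaled, non-minimal models `y² = x³ − k⁴ x` of the same curve (`k ≠ 0`). -/
def rescaledModel (k : ℤ) : WeierstrassCurve ℤ := ⟨0, 0, 0, -k ^ 4, 0⟩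

/-- `Δ (y² = x³ − x) = 64`. [folklore] -/
theorem baseModel_Δ : baseModel.Δ = 64 := by
  simp only [baseModel, WeierstrassCurve.Δ, WeierstrassCurve.b₂, WeierstrassCurve.b₄,
    WeierstrassCurve.b₆, WeierstrassCurve.b₈]
  norm_num

/-- `Δ (y² = x³ − k⁴x) = 64 k¹²`. [folklore] -/
theorem rescaledModel_Δ (k : ℤ) : (rescaledModel k).Δ = 64 * k ^ 12 := by
  simp only [rescaledModel, WeierstrassCurve.Δ, WeierstrassCurve.b₂, WeierstrassCurve.b₄,
    WeierstrassCurve.b₆, WeierstrassCurve.b₈]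
  ring

/-- Over `ℚ`, `y² = x³ − k⁴x` is the change of variables `u = k⁻¹` of `y² = x³ − x`. [folklore] -/
theorem rescaledModel_baseChange_eq_smul (k : ℤ) (hk : k ≠ 0) :
    (rescaledModel k).baseChange ℚ =
      (⟨(Units.mk0 (k : ℚ) (by exact_mod_cast hk))⁻¹, 0, 0, 0⟩ : VariableChange ℚ) •
        baseModel.baseChange ℚ := by
  ext <;> simp [rescaledModel, baseModel, baseChange, variableChange_def]

/-- `y² = x³ − x` over `ℤ` is minimal at every prime (`ord_p (Δ) = ord_p (64) < 12`). [folklore] -/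
theorem isMinimalAt_baseModel (v : HeightOneSpectrum ℤ) : (baseModel.baseChange ℚ).IsMinimalAt v := by
  refine isMinimalAt_baseChange_int_of_not_pow_dvd_Δ fun h ↦ ?_
  rw [baseModel_Δ] at h
  have hp := (Rat.HeightOneSpectrum.prime_natGenerator v).two_le
  have h64 : ((Rat.HeightOneSpectrum.natGenerator v : ℤ)) ^ 12 ≤ 64 := Int.le_of_dvd (by norm_num) h
  have h4 : (2 : ℤ) ^ 12 ≤ ((Rat.HeightOneSpectrum.natGenerator v : ℤ)) ^ 12 :=
    pow_le_pow_left₀ (by norm_num) (by exact_mod_cast hp) 12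
  linarith

/-- The minimal discriminant of the curve `y² = x³ − k⁴x` (`k ≠ 0`) is `|Δ_min| = 64`, whatever
the model. [folklore] -/
theorem minimalDiscriminantNorm_rescaledModel (k : ℤ) (hk : k ≠ 0) :
    ((rescaledModel k).baseChange ℚ).minimalDiscriminantNorm ℤ = 64 := by
  unfold minimalDiscriminantNorm
  rw [rescaledModel_baseChange_eq_smul k hk, minimalDiscriminantIdeal_smul_holds]
  change (baseModel.baseChange ℚ).minimalDiscriminantNorm ℤ = 64
  rw [minimalDiscriminantNorm_eq_natAbs_holds baseModel (by rw [baseModel_Δ]; norm_num)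
    isMinimalAt_baseModel, baseModel_Δ]
  rfl

/-- `y² = x³ − k⁴x` is an elliptic curve over `ℚ` for `k ≠ 0`. [folklore] -/
theorem isElliptic_rescaledModel (k : ℤ) (hk : k ≠ 0) : ((rescaledModel k).baseChange ℚ).IsElliptic := by
  refine ⟨isUnit_iff_ne_zero.mpr ?_⟩
  rw [baseChange_int_Δ, rescaledModel_Δ]
  exact_mod_cast mul_ne_zero (by norm_num) (pow_ne_zero 12 hk)

/-- The conductor of `y² = x³ − k⁴x` divides `64` (`N ∣ |Δ_min| = 64`; in truth `N = 32`).
[folklore] -/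
theorem conductorNorm_rescaledModel_dvd (k : ℤ) (hk : k ≠ 0) :
    ((rescaledModel k).baseChange ℚ).conductorNorm ℤ ∣ 64 := by
  haveI := isElliptic_rescaledModel k hk
  rw [← minimalDiscriminantNorm_rescaledModel k hk]
  exact conductorNorm_dvd_minimalDiscriminantNorm _
    (finite_setOf_ordMinimalDiscriminant_ne_zero_holds (A := ℤ) _)

/-- The weight of `y² = x³ − k⁴x` is at most `6` (only `p = 2` can enter, with `ord_2 ∣Δ_min| ≤ 6`),
and its conductor is at most `64`. [folklore] -/
theorem weight_rescaledModel_le (k : ℤ) (hk : k ≠ 0) :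
    (∏ p ∈ (((rescaledModel k).baseChange ℚ).conductorNorm ℤ).primeFactors with
        ¬ p ^ 2 ∣ ((rescaledModel k).baseChange ℚ).conductorNorm ℤ,
        (((rescaledModel k).baseChange ℚ).minimalDiscriminantNorm ℤ).factorization p) ≤ 6 := by
  have hN := conductorNorm_rescaledModel_dvd k hk
  have hD := minimalDiscriminantNorm_rescaledModel k hk
  set N : ℕ := ((rescaledModel k).baseChange ℚ).conductorNorm ℤ with hNdef
  have hsub : N.primeFactors.filter (fun p ↦ ¬ p ^ 2 ∣ N) ⊆ {2} := by
    intro p hp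
    rw [Finset.mem_filter, Nat.mem_primeFactors] at hp
    obtain ⟨⟨hprime, hpN, -⟩, -⟩ := hp
    have h1 : p ∣ 2 ^ 6 := hpN.trans hN
    rw [Finset.mem_singleton]
    exact (Nat.prime_dvd_prime_iff_eq hprime Nat.prime_two).mp (hprime.dvd_of_dvd_pow h1)
  have hfac : ∀ p ∈ N.primeFactors.filter (fun p ↦ ¬ p ^ 2 ∣ N),
      (((rescaledModel k).baseChange ℚ).minimalDiscriminantNorm ℤ).factorization p ≤ 6 := by
    intro p hp
    rw [hD]
    have hp2 : p = 2 := Finset.mem_singleton.mp (hsub hp)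
    subst hp2
    exact Nat.factorization_le_of_le_pow (by norm_num)
  have hT' := Finset.prod_le_pow_card _ _ 6 hfac
  have hcard : (N.primeFactors.filter (fun p ↦ ¬ p ^ 2 ∣ N)).card ≤ 1 :=
    (Finset.card_le_card hsub).trans (by simp)
  have h6 : 6 ^ (N.primeFactors.filter (fun p ↦ ¬ p ^ 2 ∣ N)).card ≤ 6 := by
    calc 6 ^ (N.primeFactors.filter (fun p ↦ ¬ p ^ 2 ∣ N)).card ≤ 6 ^ 1 :=
          Nat.pow_le_pow_right (by norm_num) hcard
      _ = 6 := by norm_num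
  exact hT'.trans h6

/-- **Any proof of the crux must use minimality of the model**: the crux with
`∀ v, IsMinimalAt v` dropped is false, whatever the class exponent `θ`. Witness: `rescaledModel k`
(`N ∣ 64`, `T ≤ 6 ≤ 6 N^θ`, `|Δ| = 64 k¹²`), at `ε = 1`, `K = 6`. [folklore] -/
theorem thinWeightedSzpiro_false_without_minimality : ¬ ThinWeightedSzpiroWithoutMinimality := by
  rintro ⟨θ, hθ, h⟩
  obtain ⟨C, hC⟩ := h 1 one_pos 6
  -- the constant `B = 384 ^ 7` bounds `(N T) ^ 7`
  set B : ℝ := (384 : ℝ) ^ ((6 : ℝ) + 1) with hB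
  have hB0 : 0 ≤ B := by positivity
  set k : ℕ := ⌈max C 0 * B⌉₊ + 1 with hk
  have hk0 : (k : ℤ) ≠ 0 := by
    have : k ≠ 0 := by omega
    exact_mod_cast this
  have hkC : max C 0 * B < k := by
    have := Nat.le_ceil (max C 0 * B)
    push_cast [hk]
    linarith
  have hk1 : (1 : ℝ) ≤ k := by exact_mod_cast Nat.succ_le_succ (Nat.zero_le _)
  haveI hE := isElliptic_rescaledModel (k : ℤ) hk0
  have hN := conductorNorm_rescaledModel_dvd (k : ℤ) hk0
  have hT6' := weight_rescaledModel_le (k : ℤ) hk0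
  -- semistability away from 2 holds: `N ∣ 64`
  have hss : ∀ p : ℕ, p.Prime → p ≠ 2 →
      ¬ p ^ 2 ∣ ((rescaledModel (k : ℤ)).baseChange ℚ).conductorNorm ℤ := by
    intro p hp hp2 hdvd
    have h1 : p ∣ 2 ^ 6 := (dvd_pow_self p two_ne_zero).trans (hdvd.trans hN)
    exact hp2 ((Nat.prime_dvd_prime_iff_eq hp Nat.prime_two).mp (hp.dvd_of_dvd_pow h1))
  -- abbreviations
  set N : ℕ := ((rescaledModel (k : ℤ)).baseChange ℚ).conductorNorm ℤ with hNdef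
  set T : ℕ := ∏ p ∈ N.primeFactors with ¬ p ^ 2 ∣ N,
    (((rescaledModel (k : ℤ)).baseChange ℚ).minimalDiscriminantNorm ℤ).factorization p with hTdef
  have hN64 : (N : ℝ) ≤ 64 := by exact_mod_cast Nat.le_of_dvd (by norm_num) hN
  have hN1 : (1 : ℝ) ≤ N := by exact_mod_cast conductorNorm_pos_holds ((rescaledModel (k : ℤ)).baseChange ℚ)
  have hT6 : (T : ℝ) ≤ 6 := by exact_mod_cast hT6'
  -- the class condition `T ≤ 6 N^θ`
  have hthin : (T : ℝ) ≤ 6 * (N : ℝ) ^ θ := by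
    have h1 : (1 : ℝ) ≤ (N : ℝ) ^ θ := Real.one_le_rpow hN1 hθ.le
    nlinarith
  have key := hC (rescaledModel (k : ℤ)) hE hss (by simpa only [hNdef, hTdef] using hthin)
  have hNT : (N : ℝ) * T ≤ 384 := by
    have hN0 : (0 : ℝ) ≤ N := by positivity
    have hT0 : (0 : ℝ) ≤ T := by positivity
    nlinarith
  have hNT0 : (0 : ℝ) ≤ (N : ℝ) * T := by positivity
  have hpow : ((N : ℝ) * T) ^ ((6 : ℝ) + 1) ≤ B := Real.rpow_le_rpow hNT0 hNT (by norm_num)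
  have hR : C * ((N : ℝ) * T) ^ ((6 : ℝ) + 1) ≤ max C 0 * B :=
    (mul_le_mul_of_nonneg_right (le_max_left C 0) (Real.rpow_nonneg hNT0 _)).trans
      (mul_le_mul_of_nonneg_left hpow (le_max_right C 0))
  -- lower bound `|Δ| = 64 k¹² ≥ k`
  have hL : (k : ℝ) ≤ ((max |(rescaledModel (k : ℤ)).Δ| (|(rescaledModel (k : ℤ)).c₄| ^ 3) : ℤ) : ℝ) := by
    rw [rescaledModel_Δ]
    push_cast
    refine le_max_of_le_left ?_
    rw [abs_of_nonneg (by positivity)]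
    have : (k : ℝ) ≤ (k : ℝ) ^ 12 := le_self_pow₀ hk1 (by norm_num)
    nlinarith
  have key' : ((max |(rescaledModel (k : ℤ)).Δ| (|(rescaledModel (k : ℤ)).c₄| ^ 3) : ℤ) : ℝ) ≤
      C * ((N : ℝ) * T) ^ ((6 : ℝ) + 1) := by
    simpa only [hNdef, hTdef] using key
  linarith



end Summit.ABC.ABC.Theorems.ThinWeightedSzpiro.Negative
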